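import Mathlib
import HarnessLib
import Literature.NumberTheory.Sieve.BatemanHorn
import Literature.NumberTheory.Sieve.BatemanHornLocalCounts
import Literature.NumberTheory.Sieve.BatemanHornMertensProduct

/-!
# Generic local structure of the Euler-species factor of a Bateman–Horn system

Stub `stub_localStructure` (E2) of line `euler-species-factorisation` of crux stmt-Parity-11291
(`Summit.Parity.BatemanHorn.Theses.AlmostPrimeZeros.SystemZeroRepulsion`).

For a Bateman–Horn system `f : Fin k → ℤ[X]`
(`Literature.NumberTheory.Sieve.IsBatemanHornSystem`), a prime `p` and `n ∈ ℕ` let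
`s_{f,p}(n) = Σ_i ([p ∣ f_i(n)] + [p² ∣ f_i(n)])` and `D = Σ_i deg f_i`.  For every prime
`p > P₀(f)`: (i) `s_{f,p}(n) ≤ 2` for all `n`; (ii) `#{n < p² : s_{f,p}(n) ≠ 0} ≤ D·p`;
(iii) `#{n < p² : s_{f,p}(n) = 2} ≤ D`.  Inputs: the tree's
`Literature.NumberTheory.Sieve.IsBatemanHornSystem.exists_localCounts` (large primes miss every
leading coefficient; no two members have a common root mod `p`; Hensel count
`#{n < p² : p² ∣ f_i(n)} ≤ deg f_i`) and Lagrange (`ρ_i(p) ≤ deg f_i`,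
`Literature.NumberTheory.Sieve.polyRootCountMod_single_le_natDegree`).
-/

namespace Summit.Parity.BatemanHorn.Cruxes.SystemZeroRepulsion.EulerSpeciesFactorisation

open Polynomial Finset

/-- A member not divisible by `p` at `n` contributes `0` to `s_{f,p}(n)` (`p² ∣ m → p ∣ m`). -/
private theorem summand_eq_zero {p : ℕ} {g : ℤ[X]} {n : ℤ} (hg : ¬ (p : ℤ) ∣ g.eval n) :
    ((if (p : ℤ) ∣ g.eval n then 1 else 0) + (if (p : ℤ) ^ 2 ∣ g.eval n then 1 else 0) : ℕ) =
      0 := by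
  have hg2 : ¬ (p : ℤ) ^ 2 ∣ g.eval n :=
    fun h => hg ((dvd_pow_self (p : ℤ) two_ne_zero).trans h)
  rw [if_neg hg, if_neg hg2]

/-- Each summand `[p ∣ m] + [p² ∣ m]` of `s_{f,p}(n)` is at most `2`. -/
private theorem ite_add_ite_le_two (P Q : Prop) [Decidable P] [Decidable Q] :
    ((if P then 1 else 0) + (if Q then 1 else 0) : ℕ) ≤ 2 := by
  split_ifs <;> omega

/-- (i) If no two members of `f` have a common root modulo `p`, then `s_{f,p}(n) ≤ 2` for every
`n`: at most one index contributes, and it contributes at most `2`. -/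
private theorem sum_le_two {k : ℕ} {f : Fin k → ℤ[X]} {p : ℕ}
    (hcop : ∀ i j, i ≠ j → ∀ n : ℤ,
      ¬ ((p : ℤ) ∣ (f i).eval n ∧ (p : ℤ) ∣ (f j).eval n))
    (n : ℕ) :
    (∑ i, ((if ((p : ℤ) ∣ (f i).eval (n : ℤ)) then 1 else 0) +
        (if ((p : ℤ) ^ 2 ∣ (f i).eval (n : ℤ)) then 1 else 0))) ≤ 2 := by
  by_cases h : ∃ i, (p : ℤ) ∣ (f i).eval (n : ℤ)
  · obtain ⟨i, hi⟩ := h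
    rw [Fintype.sum_eq_single i fun j hji => summand_eq_zero fun hj => hcop j i hji n ⟨hj, hi⟩]
    exact ite_add_ite_le_two _ _
  · push Not at h
    rw [Finset.sum_eq_zero fun j _ => summand_eq_zero (h j)]
    exact Nat.zero_le _

/-- If `s_{f,p}(n) ≠ 0` then some member is divisible by `p` at `n`. -/
private theorem exists_dvd_of_sum_ne_zero {k : ℕ} {f : Fin k → ℤ[X]} {p : ℕ} {n : ℕ}
    (h0 : (∑ i, ((if ((p : ℤ) ∣ (f i).eval (n : ℤ)) then 1 else 0) +
        (if ((p : ℤ) ^ 2 ∣ (f i).eval (n : ℤ)) then 1 else 0))) ≠ 0) :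
    ∃ i, (p : ℤ) ∣ (f i).eval (n : ℤ) := by
  by_contra h
  push Not at h
  exact h0 (Finset.sum_eq_zero fun j _ => summand_eq_zero (h j))

/-- (iii, pointwise) If no two members of `f` have a common root modulo `p` and `s_{f,p}(n) = 2`,
then `p² ∣ f_i(n)` for some `i` (the unique index divisible by `p` carries both indicators). -/
private theorem exists_sq_dvd_of_sum_eq_two {k : ℕ} {f : Fin k → ℤ[X]} {p : ℕ}
    (hcop : ∀ i j, i ≠ j → ∀ n : ℤ,
      ¬ ((p : ℤ) ∣ (f i).eval n ∧ (p : ℤ) ∣ (f j).eval n))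
    {n : ℕ}
    (h2 : (∑ i, ((if ((p : ℤ) ∣ (f i).eval (n : ℤ)) then 1 else 0) +
        (if ((p : ℤ) ^ 2 ∣ (f i).eval (n : ℤ)) then 1 else 0))) = 2) :
    ∃ i, (p : ℤ) ^ 2 ∣ (f i).eval (n : ℤ) := by
  by_cases h : ∃ i, (p : ℤ) ∣ (f i).eval (n : ℤ)
  · obtain ⟨i, hi⟩ := h
    rw [Fintype.sum_eq_single i fun j hji => summand_eq_zero fun hj => hcop j i hji n ⟨hj, hi⟩]
      at h2
    refine ⟨i, ?_⟩
    by_contra hc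
    rw [if_pos hi, if_neg hc] at h2
    omega
  · push Not at h
    rw [Finset.sum_eq_zero fun j _ => summand_eq_zero (h j)] at h2
    omega

/-- Each residue class modulo `p` meets `{0, …, p² - 1}` in at most `p` points
(`n ↦ n / p` is injective on it, into `{0, …, p - 1}`). -/
private theorem card_filter_range_sq_mod_eq_le (p a : ℕ) :
    #((range (p ^ 2)).filter fun n : ℕ => n % p = a) ≤ p := by
  calc #((range (p ^ 2)).filter fun n : ℕ => n % p = a)
      ≤ #(range p) := by
        refine Finset.card_le_card_of_injOn (fun n => n / p) ?_ ?_
        · intro n hn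
          have hn' := (mem_filter.mp (mem_coe.mp hn)).1
          rw [mem_range, sq] at hn'
          exact mem_coe.mpr (mem_range.mpr (Nat.div_lt_of_lt_mul hn'))
        · intro m hm n hn hmn
          have hm' := (mem_filter.mp (mem_coe.mp hm)).2
          have hn' := (mem_filter.mp (mem_coe.mp hn)).2
          have hmn' : m / p = n / p := hmn
          calc m = p * (m / p) + m % p := (Nat.div_add_mod m p).symm
            _ = p * (n / p) + n % p := by rw [hmn', hm', hn']
            _ = n := Nat.div_add_mod n p
    _ = p := card_range p

/-- Periodicity: `p ∣ g(n)` implies `p ∣ g(n mod p)` (`a - b ∣ g(a) - g(b)`). -/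
private theorem dvd_eval_mod {p : ℕ} {g : ℤ[X]} {n : ℕ} (h : (p : ℤ) ∣ g.eval (n : ℤ)) :
    (p : ℤ) ∣ g.eval ((n % p : ℕ) : ℤ) := by
  have h1 : (p : ℤ) ∣ (n : ℤ) - ((n % p : ℕ) : ℤ) := by
    rw [Int.natCast_emod]
    exact Int.dvd_self_sub_emod
  have h3 : (p : ℤ) ∣ g.eval (n : ℤ) - g.eval ((n % p : ℕ) : ℤ) :=
    h1.trans (Polynomial.sub_dvd_eval_sub (n : ℤ) ((n % p : ℕ) : ℤ) g)
  exact (dvd_sub_right h).mp h3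

/-- (ii) For a prime `p` missing every leading coefficient,
`#{n < p² : ∃ i, p ∣ f_i(n)} ≤ (Σ_i deg f_i)·p`: reduction modulo `p` maps this set into
the `≤ Σ_i ρ_i(p) ≤ Σ_i deg f_i` root classes (Lagrange), with fibres of size `≤ p`. -/
private theorem card_filter_exists_dvd_le {k : ℕ} (f : Fin k → ℤ[X]) {p : ℕ} (hp : p.Prime)
    (hlc : ∀ i, ¬ (p : ℤ) ∣ (f i).leadingCoeff) :
    #((range (p ^ 2)).filter fun n : ℕ => ∃ i, (p : ℤ) ∣ (f i).eval (n : ℤ)) ≤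
      (∑ i, (f i).natDegree) * p := by
  set A := (range (p ^ 2)).filter fun n : ℕ => ∃ i, (p : ℤ) ∣ (f i).eval (n : ℤ) with hA
  set R := univ.biUnion fun i : Fin k =>
    (range p).filter fun r : ℕ => (p : ℤ) ∣ (f i).eval (r : ℤ)
  have hmaps : ∀ n ∈ A, n % p ∈ R := by
    intro n hn
    rw [hA, mem_filter] at hn
    obtain ⟨-, i, hi⟩ := hn
    exact mem_biUnion.mpr
      ⟨i, mem_univ _, mem_filter.mpr ⟨mem_range.mpr (Nat.mod_lt n hp.pos), dvd_eval_mod hi⟩⟩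
  have h1 : #A ≤ p * #R := by
    refine Finset.card_le_mul_card_image_of_maps_to hmaps p fun a _ => ?_
    calc #(A.filter fun n => n % p = a)
        ≤ #((range (p ^ 2)).filter fun n : ℕ => n % p = a) := by
          refine card_le_card fun n hn => ?_
          rw [mem_filter] at hn ⊢
          rw [hA, mem_filter] at hn
          exact ⟨hn.1.1, hn.2⟩
      _ ≤ p := card_filter_range_sq_mod_eq_le p a
  have h3 : #R ≤ ∑ i, (f i).natDegree := by
    refine card_biUnion_le.trans (sum_le_sum fun i _ => ?_)
    rw [← Literature.NumberTheory.Sieve.polyRootCountMod_single]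
    exact Literature.NumberTheory.Sieve.polyRootCountMod_single_le_natDegree hp (hlc i)
  calc #A ≤ p * #R := h1
    _ ≤ p * ∑ i, (f i).natDegree := Nat.mul_le_mul_left p h3
    _ = (∑ i, (f i).natDegree) * p := mul_comm _ _

/-- **E2 (generic local structure).** For a Bateman–Horn system `f` there is `P₀` such that for
every prime `p > P₀`: (i) `s_{f,p}(n) ≤ 2` for every `n` (at most one member is divisible by `p`
at `n`); (ii) `#{n < p² : s_{f,p}(n) ≠ 0} ≤ (Σ_i deg f_i)·p` (the set is
`{n < p² : ∃ i, p ∣ f_i(n)}`, a union over the `≤ Σ_i deg f_i` root classes mod `p`, each meeting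
`range (p²)` in `p` points); (iii) `#{n < p² : s_{f,p}(n) = 2} ≤ Σ_i deg f_i` (such `n` have
`p² ∣ f_i(n)` for some `i`; Hensel count). -/
theorem stub_localStructure :
    ∀ (k : ℕ) (f : Fin k → Polynomial ℤ), Literature.NumberTheory.Sieve.IsBatemanHornSystem f →
      ∃ P₀ : ℕ, ∀ p : ℕ, p.Prime → P₀ < p →
        (∀ n : ℕ, (∑ i, ((if ((p : ℤ) ∣ (f i).eval (n : ℤ)) then 1 else 0) +
              (if ((p : ℤ) ^ 2 ∣ (f i).eval (n : ℤ)) then 1 else 0))) ≤ 2) ∧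
        (((Finset.range (p ^ 2)).filter (fun n : ℕ =>
            (∑ i, ((if ((p : ℤ) ∣ (f i).eval (n : ℤ)) then 1 else 0) +
              (if ((p : ℤ) ^ 2 ∣ (f i).eval (n : ℤ)) then 1 else 0))) ≠ 0)).card ≤
          (∑ i, (f i).natDegree) * p) ∧
        (((Finset.range (p ^ 2)).filter (fun n : ℕ =>
            (∑ i, ((if ((p : ℤ) ∣ (f i).eval (n : ℤ)) then 1 else 0) +
              (if ((p : ℤ) ^ 2 ∣ (f i).eval (n : ℤ)) then 1 else 0))) = 2)).card ≤
          ∑ i, (f i).natDegree) := by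
  intro k f hf
  obtain ⟨P₀, hP⟩ := hf.exists_localCounts
  refine ⟨P₀, fun p hp hlt => ?_⟩
  obtain ⟨hlc, hcop, hhens⟩ := hP p hp hlt
  refine ⟨sum_le_two hcop, ?_, ?_⟩
  · refine (card_le_card fun n hn => ?_).trans (card_filter_exists_dvd_le f hp hlc)
    rw [mem_filter] at hn ⊢
    exact ⟨hn.1, exists_dvd_of_sum_ne_zero hn.2⟩
  · refine (card_le_card (t := univ.biUnion fun i : Fin k =>
        (range (p ^ 2)).filter fun n : ℕ => ((p : ℤ) ^ 2) ∣ (f i).eval (n : ℤ)) ?_).trans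
      (card_biUnion_le.trans (sum_le_sum fun i _ => hhens i))
    intro n hn
    rw [mem_filter] at hn
    obtain ⟨i, hi⟩ := exists_sq_dvd_of_sum_eq_two hcop hn.2
    exact mem_biUnion.mpr ⟨i, mem_univ _, mem_filter.mpr ⟨hn.1, hi⟩⟩

end Summit.Parity.BatemanHorn.Cruxes.SystemZeroRepulsion.EulerSpeciesFactorisation
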